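import Summits.CriticalPhenomena.PercolationContinuityZ3.Theorems.PercAnnulusCrossingSlabBoxCrossingWalks
import HarnessLib

/-!
# RSW3 lane (lead GEN 35): KESTEN'S FINITE-SIZE CRITERION IN THE SLABS `S_k` — II. Halves, Kesten's five-rectangle covering, and the
# recursion `25 f(2n+1, 4n+2) ≤ (25 f(n, 2n))²`

builds on p205010 (kernel theorem, internal audit signed; external expert review pending) — NOT used in this file.

Cell `prim-rsw3` (LANE 3), lead seat, gen 35.  Support file (`--supports stmt-CriticalPhenomena-4575`); no definitions, no named
facts, no sorries.  Part of the three-file unit `…SlabBoxCrossing{Walks,Covering,Criterion}.lean`: **Newman–Tassion–Wu 2017, §3.4 —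
Kesten's finite-size criterion in the slabs `S_k = {0..k} × ℤ²` of `ℤ³` and the easy-direction box-crossing bound at the slab critical
point `p_c(S_k)`, uniformly in the thickness `k`** (their Lemma 3.12 and the second half of Lemma 3.13 — the input
`inf_n f(n,2n) > 0` of their slab RSW Theorem 3.14).

Notation (nothing is defined): `μ_p = bondPercolation (zdGraph 3) p`; the slab `S_k = {x ∈ ℤ³ : 0 ≤ x₀ ≤ k}` is the tree's
`slab 3 k` / `slabGraph 3 k` (`HalfSpace.lean`); Newman–Tassion–Wu's crossing probability of the planar rectangle `[0,m] × [0,h]`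
lifted to the slab is the lane's block crossing `f_p(m, h) := μ_p(Crossing.boxCross ![k, m, h] 1)` — the block
`{0..k} × {0..m} × {0..h}` crossed in direction `x₁` (length `m`, height `h`, thickness `k`); `f(n, 2n)` is the easy direction.

This file (II of III):
* `real_boxCross_two_mul_add_one_le_sq` — HALVES (NTW (23)): `f(2n+1, h) ≤ f(n, h)²` (an `x₁`-crossing of length `2n+1` upcrosses
  `[0,n]` and `[n+1,2n+1]`: crossings of two vertex-disjoint translates of `{0..k}×{0..n}×{0..h}`, independent);
* `real_boxCross_tall_le_five_mul` — KESTEN'S COVERING (NTW (24), Fig. 6): `f(n, 4n+2) ≤ 5 f(n, 2n)`: a crossing of the tall block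
  `{0..k}×{0..n}×{0..4n+2}` stays in one of the windows `x₂ ∈ [0,2n], [n+1,3n+1], [2n+2,4n+2]`, or upcrosses one of the strips
  `x₂ ∈ [n,2n]`, `[2n+2,3n+2]` inside `x₁ ∈ [0,n] ⊆ [0,2n]` — an `x₂`-crossing of a translate of `{0..k}×{0..2n}×{0..n}`, bounded by
  `f(n,2n)` through the swap `x₁ ↔ x₂` of file I;
* `real_boxCross_step` — THE RECURSION (NTW (25)) `25 f(2n+1, 4n+2) ≤ (25 f(n,2n))²`, and `real_boxCross_iter_le` — along
  `n_j = 2^j(n+1) − 1`: `25 f(n_j, 2n_j) ≤ (25 f(n,2n))^{2^j}`.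

References: C. M. Newman, V. Tassion, W. Wu, *Critical percolation and the minimal spanning tree in slabs*, Comm. Pure Appl.
Math. 70 (2017) 2084–2120 = arXiv:1512.09107, §3.4 Lemma 3.12, Lemma 3.13 and Fig. 6 [NewmanTassionWu2017]; H. Kesten,
*Percolation Theory for Mathematicians* (1982), §5.1 Thm. 5.1, Cor. 5.1 [Kesten1982]; G. Grimmett, *Percolation* (1999),
§1.6 (lattice symmetries), §7.2 p. 148, §11.7 [GrimmettPercolation1999].
-/

noncomputable section

namespace Summit.CriticalPhenomena.PercolationContinuityZ3.Theorems.Crossing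

open MeasureTheory Filter Topology
open Literature.Probability.Percolation Literature.Probability.LatticeModels
open Summit.CriticalPhenomena.PercolationContinuityZ3.Theorems.SurfaceTension
open Summit.CriticalPhenomena.PercolationContinuityZ3.Theorems.Rsw3

/-- **HALVES (NTW (23) in block form).**  For every `p`, `k`, `n`, `h`:
`μ_p(boxCross ![k, 2n+1, h] 1) ≤ μ_p(boxCross ![k, n, h] 1)²` — an `x₁`-crossing of `{0..k}×{0..2n+1}×{0..h}` upcrosses `[0, n]` and
`[n+1, 2n+1]`, i.e. it crosses the two vertex-disjoint halves `{0..k}×{0..n}×{0..h}` and `{0..k}×{n+1..2n+1}×{0..h}`, whose crossing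
events are independent (disjoint edge sets) and each of probability `≤ μ_p(boxCross ![k,n,h] 1)` (translation invariance).
[cite: NewmanTassionWu2017, Lemma 3.12 eq. (23)] -/
theorem real_boxCross_two_mul_add_one_le_sq (p : unitInterval) (k n h : ℕ) :
    (bondPercolation (zdGraph 3) p).real (boxCross ![(k : ℤ), 2 * n + 1, h] 1) ≤
      (bondPercolation (zdGraph 3) p).real (boxCross ![(k : ℤ), n, h] 1) ^ 2 := by
  classical
  set μ := bondPercolation (zdGraph 3) p with hμ
  -- the two halves and their face-linking events
  set B₁ : Finset (Site 3) := Finset.Icc (![0, 0, 0] : Site 3) ![(k : ℤ), (n : ℤ), (h : ℤ)] with hB₁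
  set B₂ : Finset (Site 3) := Finset.Icc (![0, (n : ℤ) + 1, 0] : Site 3) ![(k : ℤ), 2 * (n : ℤ) + 1, (h : ℤ)] with hB₂
  set E₁ : Set (BondConfig (Site 3)) := linked (↑B₁ : Set (Site 3)) {x | x ∈ B₁ ∧ x 1 = 0} {x | x ∈ B₁ ∧ x 1 = (n : ℤ)} with hE₁
  set E₂ : Set (BondConfig (Site 3)) :=
    linked (↑B₂ : Set (Site 3)) {x | x ∈ B₂ ∧ x 1 = (n : ℤ) + 1} {x | x ∈ B₂ ∧ x 1 = 2 * (n : ℤ) + 1} with hE₂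
  -- (a) the crossing implies both
  have hsub : μ.real (boxCross ![(k : ℤ), 2 * n + 1, h] 1) ≤ μ.real (E₁ ∩ E₂) := by
    refine DCT16.real_mono_of_forall_subset_edgeSet (zdGraph 3) p fun ω hω hmem => ?_
    obtain ⟨x, y, hx, hy, hx1, hy1, ⟨W⟩⟩ := exists_walk_of_mem_boxCross hω hmem
    have hy1' : y 1 = 2 * (n : ℤ) + 1 := by rw [hy1]; simp
    have hx' : x ∈ Finset.Icc (0 : Site 3) ![(k : ℤ), 2 * (n : ℤ) + 1, (h : ℤ)] := by simpa using hx
    have W' : (openGraph ω ⊓ withinGraph (zdGraph 3)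
        (↑(Finset.Icc (0 : Site 3) ![(k : ℤ), 2 * (n : ℤ) + 1, (h : ℤ)]) : Set (Site 3))).Walk x y := by
      simpa using W
    refine ⟨?_, ?_⟩
    · have h1 := mem_linked_slice_one W' hx' (ℓ₁ := 0) (ℓ₂ := (n : ℤ)) (by positivity) (Nat.zero_le _) le_rfl
        (by rw [SimpleGraph.Walk.getVert_zero, hx1]) (by rw [SimpleGraph.Walk.getVert_length, hy1']; linarith)
      rw [hE₁, hB₁]; exact h1
    · have h2 := mem_linked_slice_one W' hx' (ℓ₁ := (n : ℤ) + 1) (ℓ₂ := 2 * (n : ℤ) + 1) (by linarith) (Nat.zero_le _) le_rfl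
        (by rw [SimpleGraph.Walk.getVert_zero, hx1]; positivity) (by rw [SimpleGraph.Walk.getVert_length, hy1'])
      rw [hE₂, hB₂]; exact h2
  -- (b) independence
  have hdisj : Disjoint B₁ B₂ := by
    rw [Finset.disjoint_left]
    intro z hz1 hz2
    rw [hB₁, mem_Icc_vec3_iff'] at hz1
    rw [hB₂, mem_Icc_vec3_iff'] at hz2
    linarith [hz1.2.1.2, hz2.2.1.1]
  have hprod : μ.real (E₁ ∩ E₂) = μ.real E₁ * μ.real E₂ :=
    bondPercolation_real_inter_of_disjoint (zdGraph 3) p (disjoint_edgesIn_of_disjoint hdisj)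
      (determinedBy_linked_edgesIn B₁ _ _) (determinedBy_linked_edgesIn B₂ _ _) (measurableSet_linked _ _ _)
      (measurableSet_linked _ _ _)
  -- (c) each half is a translate of `{0..k}×{0..n}×{0..h}`
  have hL : ∀ j, 0 ≤ (![(k : ℤ), (n : ℤ), (h : ℤ)] : Site 3) j := by
    intro j; fin_cases j <;> simp
  have hE₁le : μ.real E₁ ≤ μ.real (boxCross ![(k : ℤ), n, h] 1) := by
    have h1 := real_linked_faces_shift_le p (![0, 0, 0] : Site 3) ![(k : ℤ), (n : ℤ), (h : ℤ)] hL 1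
    have hv : (![0, 0, 0] : Site 3) + ![(k : ℤ), (n : ℤ), (h : ℤ)] = ![(k : ℤ), (n : ℤ), (h : ℤ)] := by
      ext j; fin_cases j <;> simp
    rw [hv] at h1
    rw [hE₁, hB₁]
    simpa using h1
  have hE₂le : μ.real E₂ ≤ μ.real (boxCross ![(k : ℤ), n, h] 1) := by
    have h1 := real_linked_faces_shift_le p (![0, (n : ℤ) + 1, 0] : Site 3) ![(k : ℤ), (n : ℤ), (h : ℤ)] hL 1
    have hv : (![0, (n : ℤ) + 1, 0] : Site 3) + ![(k : ℤ), (n : ℤ), (h : ℤ)] = ![(k : ℤ), 2 * (n : ℤ) + 1, (h : ℤ)] := by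
      ext j; fin_cases j <;> simp; ring
    rw [hv] at h1
    have hface : (![0, (n : ℤ) + 1, 0] : Site 3) 1 + (![(k : ℤ), (n : ℤ), (h : ℤ)] : Site 3) 1 = 2 * (n : ℤ) + 1 := by
      simp; ring
    rw [hface] at h1
    rw [hE₂, hB₂]
    simpa using h1
  have h0 : 0 ≤ μ.real E₂ := measureReal_nonneg
  calc μ.real (boxCross ![(k : ℤ), 2 * n + 1, h] 1) ≤ μ.real (E₁ ∩ E₂) := hsub
    _ = μ.real E₁ * μ.real E₂ := hprod
    _ ≤ μ.real (boxCross ![(k : ℤ), n, h] 1) * μ.real (boxCross ![(k : ℤ), n, h] 1) :=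
        mul_le_mul hE₁le hE₂le h0 measureReal_nonneg
    _ = _ := by ring


/-! ## §4 Kesten's five-rectangle covering: `f(n, 4n+2) ≤ 5 f(n, 2n)` -/

/-- A window event is bounded by the easy crossing: for every `c ∈ ℤ`,
`μ_p({x₁ = 0} ↔ {x₁ = n} in {0..k}×{0..n}×{c..c+2n}) ≤ μ_p(boxCross ![k, n, 2n] 1)` (translation by `(0,0,c)`). [folklore] -/
theorem real_linked_window_le (p : unitInterval) (k n : ℕ) (c : ℤ) :
    (bondPercolation (zdGraph 3) p).real
        (linked (↑(Finset.Icc (![0, 0, c] : Site 3) ![(k : ℤ), (n : ℤ), c + 2 * (n : ℤ)]) : Set (Site 3))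
          {x | x ∈ Finset.Icc (![0, 0, c] : Site 3) ![(k : ℤ), (n : ℤ), c + 2 * (n : ℤ)] ∧ x 1 = 0}
          {x | x ∈ Finset.Icc (![0, 0, c] : Site 3) ![(k : ℤ), (n : ℤ), c + 2 * (n : ℤ)] ∧ x 1 = (n : ℤ)}) ≤
      (bondPercolation (zdGraph 3) p).real (boxCross ![(k : ℤ), n, 2 * n] 1) := by
  have hL : ∀ j, 0 ≤ (![(k : ℤ), (n : ℤ), 2 * (n : ℤ)] : Site 3) j := by intro j; fin_cases j <;> simp
  have h1 := real_linked_faces_shift_le p (![0, 0, c] : Site 3) ![(k : ℤ), (n : ℤ), 2 * (n : ℤ)] hL 1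
  have hv : (![0, 0, c] : Site 3) + ![(k : ℤ), (n : ℤ), 2 * (n : ℤ)] = ![(k : ℤ), (n : ℤ), c + 2 * (n : ℤ)] := by
    ext j; fin_cases j <;> simp
  rw [hv] at h1
  simpa using h1

/-- A strip event is bounded by the easy crossing: for every `c ∈ ℤ`,
`μ_p({x₂ = c} ↔ {x₂ = c+n} in {0..k}×{0..2n}×{c..c+n}) ≤ μ_p(boxCross ![k, 2n, n] 2) ≤ μ_p(boxCross ![k, n, 2n] 1)` (translation, then the
swap `x₁ ↔ x₂`). [folklore] -/
theorem real_linked_strip_le (p : unitInterval) (k n : ℕ) (c : ℤ) :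
    (bondPercolation (zdGraph 3) p).real
        (linked (↑(Finset.Icc (![0, 0, c] : Site 3) ![(k : ℤ), 2 * (n : ℤ), c + (n : ℤ)]) : Set (Site 3))
          {x | x ∈ Finset.Icc (![0, 0, c] : Site 3) ![(k : ℤ), 2 * (n : ℤ), c + (n : ℤ)] ∧ x 2 = c}
          {x | x ∈ Finset.Icc (![0, 0, c] : Site 3) ![(k : ℤ), 2 * (n : ℤ), c + (n : ℤ)] ∧ x 2 = c + (n : ℤ)}) ≤
      (bondPercolation (zdGraph 3) p).real (boxCross ![(k : ℤ), n, 2 * n] 1) := by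
  have hL : ∀ j, 0 ≤ (![(k : ℤ), 2 * (n : ℤ), (n : ℤ)] : Site 3) j := by intro j; fin_cases j <;> simp
  have h1 := real_linked_faces_shift_le p (![0, 0, c] : Site 3) ![(k : ℤ), 2 * (n : ℤ), (n : ℤ)] hL 2
  have hv : (![0, 0, c] : Site 3) + ![(k : ℤ), 2 * (n : ℤ), (n : ℤ)] = ![(k : ℤ), 2 * (n : ℤ), c + (n : ℤ)] := by
    ext j; fin_cases j <;> simp
  rw [hv] at h1
  have h2 : (bondPercolation (zdGraph 3) p).real (boxCross ![(k : ℤ), 2 * (n : ℤ), (n : ℤ)] 2) ≤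
      (bondPercolation (zdGraph 3) p).real (boxCross ![(k : ℤ), n, 2 * n] 1) := by
    simpa using real_boxCross_swap12_le p (k : ℤ) (2 * (n : ℤ)) (c := (n : ℤ)) (by positivity)
  exact le_trans (by simpa using h1) h2

/-- **KESTEN'S COVERING (NTW Lemma 3.12, Fig. 6, in block form).**  For every `p`, `k`, `n`:
`μ_p(boxCross ![k, n, 4n+2] 1) ≤ 5 · μ_p(boxCross ![k, n, 2n] 1)`.  An open crossing of the tall block `{0..k}×{0..n}×{0..4n+2}` in
direction `x₁` either stays in one of the windows `x₂ ∈ [0, 2n]`, `[n+1, 3n+1]`, `[2n+2, 4n+2]` — an `x₁`-crossing of a translate of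
`{0..k}×{0..n}×{0..2n}` — or visits both `{x₂ ≤ n}` and `{x₂ ≥ 2n+1}`, or both `{x₂ ≤ 2n+1}` and `{x₂ ≥ 3n+2}`, in which case it (or its
reversal) upcrosses the strip `x₂ ∈ [n, 2n]` or `[2n+2, 3n+2]` inside `x₁ ∈ [0, n] ⊆ [0, 2n]`: an `x₂`-crossing of a translate of
`{0..k}×{0..2n}×{0..n}`.  Union bound, translation invariance and the swap `x₁ ↔ x₂`. [cite: NewmanTassionWu2017, Lemma 3.12 eq. (24) and Fig. 6] -/
theorem real_boxCross_tall_le_five_mul (p : unitInterval) (k n : ℕ) :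
    (bondPercolation (zdGraph 3) p).real (boxCross ![(k : ℤ), n, 4 * n + 2] 1) ≤
      5 * (bondPercolation (zdGraph 3) p).real (boxCross ![(k : ℤ), n, 2 * n] 1) := by
  classical
  set μ := bondPercolation (zdGraph 3) p with hμ
  -- the five events
  set X : ℤ → Set (BondConfig (Site 3)) := fun c =>
    linked (↑(Finset.Icc (![0, 0, c] : Site 3) ![(k : ℤ), (n : ℤ), c + 2 * (n : ℤ)]) : Set (Site 3))
      {x | x ∈ Finset.Icc (![0, 0, c] : Site 3) ![(k : ℤ), (n : ℤ), c + 2 * (n : ℤ)] ∧ x 1 = 0}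
      {x | x ∈ Finset.Icc (![0, 0, c] : Site 3) ![(k : ℤ), (n : ℤ), c + 2 * (n : ℤ)] ∧ x 1 = (n : ℤ)} with hX
  set Y : ℤ → Set (BondConfig (Site 3)) := fun c =>
    linked (↑(Finset.Icc (![0, 0, c] : Site 3) ![(k : ℤ), 2 * (n : ℤ), c + (n : ℤ)]) : Set (Site 3))
      {x | x ∈ Finset.Icc (![0, 0, c] : Site 3) ![(k : ℤ), 2 * (n : ℤ), c + (n : ℤ)] ∧ x 2 = c}
      {x | x ∈ Finset.Icc (![0, 0, c] : Site 3) ![(k : ℤ), 2 * (n : ℤ), c + (n : ℤ)] ∧ x 2 = c + (n : ℤ)} with hY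
  -- (a) the covering
  have hsub : μ.real (boxCross ![(k : ℤ), n, 4 * n + 2] 1) ≤
      μ.real ((((X 0 ∪ X ((n : ℤ) + 1)) ∪ X (2 * (n : ℤ) + 2)) ∪ Y (n : ℤ)) ∪ Y (2 * (n : ℤ) + 2)) := by
    refine DCT16.real_mono_of_forall_subset_edgeSet (zdGraph 3) p fun ω hω hmem => ?_
    obtain ⟨x, y, hx, hy, hx1, hy1, ⟨W⟩⟩ := exists_walk_of_mem_boxCross hω hmem
    have hy1' : y 1 = (n : ℤ) := by rw [hy1]; simp
    have hx' : x ∈ Finset.Icc (0 : Site 3) ![(k : ℤ), (n : ℤ), 4 * (n : ℤ) + 2] := by simpa using hx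
    have hy' : y ∈ Finset.Icc (0 : Site 3) ![(k : ℤ), (n : ℤ), 4 * (n : ℤ) + 2] := by simpa using hy
    have W' : (openGraph ω ⊓ withinGraph (zdGraph 3)
        (↑(Finset.Icc (0 : Site 3) ![(k : ℤ), (n : ℤ), 4 * (n : ℤ) + 2]) : Set (Site 3))).Walk x y := by
      simpa using W
    have hblk := getVert_mem_block W' hx'
    have hn0 : (0 : ℤ) ≤ n := by positivity
    set len := W'.length with hlen
    by_cases hP1 : ∀ t, t ≤ len → W'.getVert t 2 ≤ 2 * (n : ℤ)
    · -- window `[0, 2n]`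
      have h := mem_linked_window W' hx' hx1 hy1' (c := 0) (w := 2 * (n : ℤ))
        (fun t ht => ⟨(hblk t).2.2.1, by linarith [hP1 t ht]⟩)
      exact Or.inl (Or.inl (Or.inl (Or.inl h)))
    by_cases hP2 : ∀ t, t ≤ len → 2 * (n : ℤ) + 2 ≤ W'.getVert t 2
    · -- window `[2n+2, 4n+2]`
      have h := mem_linked_window W' hx' hx1 hy1' (c := 2 * (n : ℤ) + 2) (w := 2 * (n : ℤ))
        (fun t ht => ⟨hP2 t ht, by linarith [(hblk t).2.2.2]⟩)
      exact Or.inl (Or.inl (Or.inr h))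
    by_cases hP3 : ∀ t, t ≤ len → (n : ℤ) + 1 ≤ W'.getVert t 2 ∧ W'.getVert t 2 ≤ 3 * (n : ℤ) + 1
    · -- window `[n+1, 3n+1]`
      have h := mem_linked_window W' hx' hx1 hy1' (c := (n : ℤ) + 1) (w := 2 * (n : ℤ))
        (fun t ht => ⟨(hP3 t ht).1, by linarith [(hP3 t ht).2]⟩)
      exact Or.inl (Or.inl (Or.inl (Or.inr h)))
    -- otherwise: an upcrossing of a strip
    push Not at hP1 hP2 hP3
    obtain ⟨t₁, ht₁, h1⟩ := hP1
    obtain ⟨t₂, ht₂, h2⟩ := hP2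
    obtain ⟨t₃, ht₃, h3⟩ := hP3
    -- reversed walk bookkeeping
    have hrev : ∀ t, t ≤ len → W'.reverse.getVert (len - t) = W'.getVert t := by
      intro t ht
      rw [SimpleGraph.Walk.getVert_reverse, hlen, Nat.sub_sub_self ht]
    have hlenr : W'.reverse.length = len := by rw [SimpleGraph.Walk.length_reverse]
    by_cases hlow : W'.getVert t₃ 2 ≤ (n : ℤ)
    · -- the strip `[n, 2n]`, between `t₃` (low) and `t₁` (high)
      have hY1 : ω ∈ Y (n : ℤ) := by
        rcases le_total t₃ t₁ with h31 | h13
        · have h := mem_linked_slice_two W' hx' (m := 2 * (n : ℤ)) (by linarith) (ℓ₁ := (n : ℤ)) (ℓ₂ := 2 * (n : ℤ))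
            (by linarith) h31 ht₁ hlow (by linarith)
          simpa [hY, two_mul] using h
        · have h := mem_linked_slice_two W'.reverse hy' (m := 2 * (n : ℤ)) (by linarith) (ℓ₁ := (n : ℤ))
            (ℓ₂ := 2 * (n : ℤ)) (by linarith) (t₀ := len - t₃) (t₁ := len - t₁) (by omega) (by rw [hlenr]; omega)
            (by rw [hrev t₃ ht₃]; exact hlow) (by rw [hrev t₁ ht₁]; linarith)
          simpa [hY, two_mul] using h
      exact Or.inl (Or.inr hY1)
    · -- the strip `[2n+2, 3n+2]`, between `t₂` (low) and `t₃` (high)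
      push Not at hlow
      have hhigh : 3 * (n : ℤ) + 2 ≤ W'.getVert t₃ 2 := by
        have := h3 (by linarith)
        linarith
      have hY2 : ω ∈ Y (2 * (n : ℤ) + 2) := by
        rcases le_total t₂ t₃ with h23 | h32
        · have h := mem_linked_slice_two W' hx' (m := 2 * (n : ℤ)) (by linarith) (ℓ₁ := 2 * (n : ℤ) + 2)
            (ℓ₂ := 3 * (n : ℤ) + 2) (by linarith) h23 ht₃ (by linarith) hhigh
          have e : 2 * (n : ℤ) + 2 + (n : ℤ) = 3 * (n : ℤ) + 2 := by ring
          simpa [hY, e] using h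
        · have h := mem_linked_slice_two W'.reverse hy' (m := 2 * (n : ℤ)) (by linarith) (ℓ₁ := 2 * (n : ℤ) + 2)
            (ℓ₂ := 3 * (n : ℤ) + 2) (by linarith) (t₀ := len - t₂) (t₁ := len - t₃) (by omega) (by rw [hlenr]; omega)
            (by rw [hrev t₂ ht₂]; linarith) (by rw [hrev t₃ ht₃]; exact hhigh)
          have e : 2 * (n : ℤ) + 2 + (n : ℤ) = 3 * (n : ℤ) + 2 := by ring
          simpa [hY, e] using h
      exact Or.inr hY2
  -- (b) union bound and the five estimates
  have hXle : ∀ c : ℤ, μ.real (X c) ≤ μ.real (boxCross ![(k : ℤ), n, 2 * n] 1) := fun c => by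
    rw [hX]; exact real_linked_window_le p k n c
  have hYle : ∀ c : ℤ, μ.real (Y c) ≤ μ.real (boxCross ![(k : ℤ), n, 2 * n] 1) := fun c => by
    rw [hY]; exact real_linked_strip_le p k n c
  have hU : μ.real ((((X 0 ∪ X ((n : ℤ) + 1)) ∪ X (2 * (n : ℤ) + 2)) ∪ Y (n : ℤ)) ∪ Y (2 * (n : ℤ) + 2)) ≤
      μ.real (X 0) + μ.real (X ((n : ℤ) + 1)) + μ.real (X (2 * (n : ℤ) + 2)) + μ.real (Y (n : ℤ)) + μ.real (Y (2 * (n : ℤ) + 2)) := by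
    refine (measureReal_union_le _ _).trans ?_
    refine add_le_add ((measureReal_union_le _ _).trans ?_) le_rfl
    refine add_le_add ((measureReal_union_le _ _).trans ?_) le_rfl
    exact add_le_add (measureReal_union_le _ _) le_rfl
  linarith [hXle 0, hXle ((n : ℤ) + 1), hXle (2 * (n : ℤ) + 2), hYle (n : ℤ), hYle (2 * (n : ℤ) + 2), hsub, hU]


/-! ## §5 The recursion `u(2n+1) ≤ u(n)²` for `u(n) = 25 f(n, 2n)` and its iteration -/

/-- **THE RECURSION (NTW (25)).**  For every `p`, `k`, `n`: `25 · μ_p(boxCross ![k, 2n+1, 4n+2] 1) ≤ (25 · μ_p(boxCross ![k, n, 2n] 1))²`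
(halves, then the covering: `f(2n+1, 4n+2) ≤ f(n, 4n+2)² ≤ (5 f(n,2n))²`). [cite: NewmanTassionWu2017, Lemma 3.12 eq. (25)] -/
theorem real_boxCross_step (p : unitInterval) (k n : ℕ) :
    25 * (bondPercolation (zdGraph 3) p).real (boxCross ![(k : ℤ), 2 * n + 1, 4 * n + 2] 1) ≤
      (25 * (bondPercolation (zdGraph 3) p).real (boxCross ![(k : ℤ), n, 2 * n] 1)) ^ 2 := by
  have h1 := real_boxCross_two_mul_add_one_le_sq p k n (4 * n + 2)
  push_cast at h1
  have h2 := real_boxCross_tall_le_five_mul p k n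
  have h0 : 0 ≤ (bondPercolation (zdGraph 3) p).real (boxCross ![(k : ℤ), n, 4 * n + 2] 1) := measureReal_nonneg
  nlinarith [h1, h2, h0, pow_le_pow_left₀ h0 h2 2]

/-- **Iteration along `n_j = 2^j (n+1) − 1`** (`n_{j+1} = 2 n_j + 1`): for every `p`, `k`, `n`, `j`,
`25 · μ_p(boxCross ![k, n_j, 2 n_j] 1) ≤ (25 · μ_p(boxCross ![k, n, 2n] 1))^{2^j}`. [cite: NewmanTassionWu2017, Lemma 3.12 (induction on eq. (25))] -/
theorem real_boxCross_iter_le (p : unitInterval) (k n j : ℕ) :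
    25 * (bondPercolation (zdGraph 3) p).real
        (boxCross ![(k : ℤ), ((2 ^ j * (n + 1) - 1 : ℕ) : ℤ), 2 * ((2 ^ j * (n + 1) - 1 : ℕ) : ℤ)] 1) ≤
      (25 * (bondPercolation (zdGraph 3) p).real (boxCross ![(k : ℤ), n, 2 * n] 1)) ^ (2 ^ j) := by
  induction j with
  | zero =>
    have h : (2 ^ 0 * (n + 1) - 1 : ℕ) = n := by simp
    rw [h, pow_zero, pow_one]
  | succ j ih =>
    set M : ℕ := 2 ^ j * (n + 1) - 1 with hM
    have hM1 : 1 ≤ 2 ^ j * (n + 1) := Nat.one_le_iff_ne_zero.2 (by positivity)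
    have hsucc : (2 ^ (j + 1) * (n + 1) - 1 : ℕ) = 2 * M + 1 := by
      rw [hM, pow_succ]
      have : 2 ^ j * 2 * (n + 1) = 2 * (2 ^ j * (n + 1)) := by ring
      rw [this]; omega
    rw [hsucc]
    have hstep := real_boxCross_step p k M
    have hcast : (![(k : ℤ), ((2 * M + 1 : ℕ) : ℤ), 2 * ((2 * M + 1 : ℕ) : ℤ)] : Site 3) = ![(k : ℤ), 2 * M + 1, 4 * M + 2] := by
      ext i; fin_cases i <;> push_cast <;> ring
    rw [hcast, pow_succ, pow_mul]
    have h0 : 0 ≤ 25 * (bondPercolation (zdGraph 3) p).real (boxCross ![(k : ℤ), (M : ℤ), 2 * (M : ℤ)] 1) := by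
      have := (measureReal_nonneg : 0 ≤ (bondPercolation (zdGraph 3) p).real (boxCross ![(k : ℤ), (M : ℤ), 2 * (M : ℤ)] 1))
      positivity
    calc 25 * (bondPercolation (zdGraph 3) p).real (boxCross ![(k : ℤ), 2 * (M : ℤ) + 1, 4 * (M : ℤ) + 2] 1)
        ≤ (25 * (bondPercolation (zdGraph 3) p).real (boxCross ![(k : ℤ), (M : ℤ), 2 * (M : ℤ)] 1)) ^ 2 := by
          simpa using hstep
      _ ≤ ((25 * (bondPercolation (zdGraph 3) p).real (boxCross ![(k : ℤ), n, 2 * n] 1)) ^ 2 ^ j) ^ 2 :=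
          pow_le_pow_left₀ h0 (by simpa using ih) 2

end Summit.CriticalPhenomena.PercolationContinuityZ3.Theorems.Crossing

end
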